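import Mathlib

/-!
# Pushforward of pencil dependencies to a restricted ground set

Helper file for crux `stmt-CriticalPhenomena-4575` (`NoHeavyLowerTail`, route `PercNearOneGluingNoHeavy`),
new-inequality factory seat `prim-ineq-gen-3` (gen 25).  Everything here is PROVED; no definitions.

For a finite family `𝒜` of finite sets, a column set `𝒞`, a scalar `t` and coefficients `c`, a DEPENDENCY of the Marica–Schönheim
pencil is `∑_{C ∈ 𝒜} c_C ([E ⊆ C] + t [E ∩ C = ∅]) = 0` for all `E ∈ 𝒞`.  For a column `E ⊆ W` both incidences `[E ⊆ C]` and
`[E ∩ C = ∅]` depend only on the trace `C ∩ W`; hence the PUSHFORWARD `w(X) = ∑_{C ∈ 𝒜, C ∩ W = X} c_C` of `c` along `C ↦ C ∩ W` is a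
dependency of the restricted family `{C ∩ W : C ∈ 𝒜}` for the columns of `𝒞` inside `W` (`dep_pushforward_inter`).  This is the
reduction behind every 'minimal counterexample' argument for the pencil conjectures (memo
`run/shared/lean/prim/prim-ineq-gen-3/FINDINGS-gen25.md` F25-6): if the restricted family has no dependency at `t` on those columns,
all `W`-trace-class sums of `c` vanish (`traceClassSum_eq_zero_of_restricted_injective`); with `W = A ∈ 𝒜` this is the trace
grouping of `…OrderedDifferencesLocal`, with `W = S \ A` the co-trace grouping of `…OrderedDifferencesOrderFilter`.
(prim-ineq-gen-3 gen 25, 2026-08-24.)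
-/

namespace Summit.CriticalPhenomena.PercolationContinuityZ3.Theorems

namespace OrderedDifferences

open Finset

variable {α : Type*} [DecidableEq α] {K : Type*} [Field K]

/-- **Pushforward of a dependency along `C ↦ C ∩ W`.**  If `c` is a dependency of the pencil rows of `𝒜` at `t` on the columns `𝒞`,
then for every column `E ∈ 𝒞` with `E ⊆ W` the pushed-forward coefficients `w(X) = ∑_{C ∈ 𝒜, C ∩ W = X} c_C` satisfy the same
equation in the restricted family `𝒜.image (· ∩ W)`. -/
theorem dep_pushforward_inter (𝒜 𝒞 : Finset (Finset α)) (W : Finset α) (t : K) (c : Finset α → K)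
    (hdep : ∀ E ∈ 𝒞, ∑ C ∈ 𝒜, c C * ((if E ⊆ C then (1 : K) else 0) +
      t * (if Disjoint E C then (1 : K) else 0)) = 0)
    {E : Finset α} (hE : E ∈ 𝒞) (hEW : E ⊆ W) :
    ∑ X ∈ 𝒜.image (fun C => C ∩ W), (∑ C ∈ 𝒜.filter (fun C => C ∩ W = X), c C) *
      ((if E ⊆ X then (1 : K) else 0) + t * (if Disjoint E X then (1 : K) else 0)) = 0 := by
  classical
  have hmaps : ∀ C ∈ 𝒜, C ∩ W ∈ 𝒜.image (fun C => C ∩ W) := fun C hC => mem_image_of_mem _ hC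
  have key : ∑ X ∈ 𝒜.image (fun C => C ∩ W), (∑ C ∈ 𝒜.filter (fun C => C ∩ W = X), c C) *
      ((if E ⊆ X then (1 : K) else 0) + t * (if Disjoint E X then (1 : K) else 0)) =
      ∑ C ∈ 𝒜, c C * ((if E ⊆ C then (1 : K) else 0) + t * (if Disjoint E C then (1 : K) else 0)) := by
    rw [← sum_fiberwise_of_maps_to hmaps]
    refine sum_congr rfl fun X _ => ?_
    rw [sum_mul]
    refine sum_congr rfl fun C hC => ?_
    obtain ⟨_, hCX⟩ := mem_filter.mp hC
    have e1 : (E ⊆ C) ↔ (E ⊆ X) := by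
      rw [← hCX]
      constructor
      · intro h x hx
        exact mem_inter.mpr ⟨h hx, hEW hx⟩
      · intro h x hx
        exact (mem_inter.mp (h hx)).1
    have e2 : Disjoint E C ↔ Disjoint E X := by
      rw [← hCX, disjoint_left, disjoint_left]
      constructor
      · intro h x hx hx'
        exact h hx (mem_inter.mp hx').1
      · intro h x hx hxC
        exact h hx (mem_inter.mpr ⟨hxC, hEW hx⟩)
    congr 2
    · exact if_congr e1.symm rfl rfl
    · congr 1
      exact if_congr e2.symm rfl rfl
  rw [key]
  exact hdep E hE

/-- **Vanishing of trace-class sums.**  If the restricted family `{C ∩ W : C ∈ 𝒜}` has NO non-zero dependency at `t` on the columns of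
`𝒞` inside `W` (stated as injectivity for arbitrary coefficient functions), then every dependency `c` of `𝒜` on `𝒞` has vanishing
`W`-trace-class sums: `∑_{C ∈ 𝒜, C ∩ W = B ∩ W} c_C = 0` for all `B ∈ 𝒜`. -/
theorem traceClassSum_eq_zero_of_restricted_injective (𝒜 𝒞 : Finset (Finset α)) (W : Finset α) (t : K)
    (hinj : ∀ w : Finset α → K,
      (∀ E ∈ 𝒞, E ⊆ W → ∑ X ∈ 𝒜.image (fun C => C ∩ W), w X *
        ((if E ⊆ X then (1 : K) else 0) + t * (if Disjoint E X then (1 : K) else 0)) = 0) →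
      ∀ X ∈ 𝒜.image (fun C => C ∩ W), w X = 0)
    (c : Finset α → K)
    (hdep : ∀ E ∈ 𝒞, ∑ C ∈ 𝒜, c C * ((if E ⊆ C then (1 : K) else 0) +
      t * (if Disjoint E C then (1 : K) else 0)) = 0) :
    ∀ B ∈ 𝒜, ∑ C ∈ 𝒜.filter (fun C => C ∩ W = B ∩ W), c C = 0 := by
  classical
  intro B hB
  have h := hinj (fun X => ∑ C ∈ 𝒜.filter (fun C => C ∩ W = X), c C)
    (fun E hE hEW => dep_pushforward_inter 𝒜 𝒞 W t c hdep hE hEW) (B ∩ W) (mem_image_of_mem _ hB)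
  exact h

end OrderedDifferences

end Summit.CriticalPhenomena.PercolationContinuityZ3.Theorems
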